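import Literature.Analysis.OperatorTheory.Enflo2023.RoomClaim
import Mathlib.Analysis.InnerProductSpace.l2Space
import Mathlib.Analysis.InnerProductSpace.Adjoint
import Mathlib.Analysis.PSeries
import Mathlib.Analysis.Normed.Algebra.Spectrum
import HarnessLib

/-!
# Enflo 2023, v2 p.20 after (46): the room claim WITH THE OPERATOR IN IT, refuted for a self-adjoint `T`

Source under adjudication: Per H. Enflo, *On the invariant subspace problem in Hilbert spaces*, arXiv:2305.15442 (v1
2023, v2 2024), bib key `Enflo2023` — a CLAIMED proof of the invariant subspace problem for operators on a separable
Hilbert space.  This file is part of the kernel-tight typing of the manuscript by the b2b-enflo repair cell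
(formaliser 2, Part B: (28)–(47), the limiting argument and the final deduction).  It records what FOLLOWS (proved
implications from the manuscript's displayed hypotheses) and, where a step does not follow, the typed inference
together with its refutation.  NOTHING here asserts that the manuscript's main theorem holds; no declaration concludes
the invariant subspace problem for an arbitrary operator.  Value (BLOCK-2b): theorems / refutations of typed
inferences about a text — not progress on the problem.

REPAIR-CENSUS rows R9 / R10 (GAP.md §Formaliser 2): "does a hypothesis OF SPECTRAL TYPE on `T` — normal, essentially
normal, compact perturbation of self-adjoint — repair the located gap, the room claim of v2 p.20 (NORM convergence of
the Main-Construction iterates, `RoomClaim.lean`)?"  `RoomClaim ρ` does not mention `T`, so the honest test is the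
claim with the operator written into it: `RoomClaimT ρ` = the facts of `RoomClaim` (iterates, `(εθ)_n ↓ 0` at ratio
`≤ 1 − β`, the p.19–20 step identities `⟨x₀, Δv⟩ = O(β(εθ)_n)`, `⟨w₀₀, Δv⟩ = 0`) + the manuscript's standing
hypotheses on `T` (v2 pp.1–2, tex:L61 / L221: injective, `R(T) ≠ H`, `R(T)` dense, `0 ∈ σ(T)`, `‖T‖_op = 10⁻²⁰`) + `T`
SELF-ADJOINT (the strongest hypothesis of the census: self-adjoint ⊂ normal ⊂ essentially normal, and "self-adjoint +
compact" with compact part `0`) + the p.4 facts the endgame uses: the distance window `0.3 ≤ ‖x₀ − v_n‖ ≤ 0.7` and (9)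
for ALL powers, `|⟨T^j v_n, x₀ − v_n⟩| ≤ (εθ)_n`.  VERDICT: `not_roomClaimT : ∀ ρ < 0.6, ¬ RoomClaimT ρ`.  Witness on
`ℓ²(ℕ)`: the diagonal operator `D` with weights `10⁻²⁰` on `e₀,…,e₃` and `10⁻²⁰/(k+1)` beyond (self-adjoint, injective,
dense non-closed range, `0 ∈ σ(D)`, `‖D‖ = 10⁻²⁰`; incidentally compact — not typed), and the model iterates of
`RoomClaim.lean` shifted by `e₀/5`, `v_n = (3/5)e₀ + d_n u_n` with `u_n` alternating between `e₂` and `e₃`: `D` acts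
on them as the scalar `10⁻²⁰`, so (9) holds with room to spare (`|⟨x₀ − v_n, D^j v_n⟩| = 10^{-20j}(εθ)_n`), every
listed fact holds exactly, and the iterates move by `≥ 0.67` at every step forever.  So: for the classes of R9/R10 the
THEOREM is known (normal) resp. open (essentially normal), but the manuscript's MECHANISM — the p.20 inference — is
false for them; no hypothesis of spectral type on `T` enters the justification the text gives, and none can repair it.
What would: a summability / compactness statement about the steps (`RoomsSuffice.lean`), or compactness of some
`p(T)`, which closes the endgame by a different route (`CompactCase.lean`, `PolyCompactCase.lean`).
`roomClaimT_of_roomClaim`: the T-aware claim is the WEAKER statement, so this refutation implies `not_roomClaim`'s.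
STATUS: CLOSED (zero sorry).  Origin: planner-b2b-enflo-2-g2-0 (formaliser 2, gen 2), 2026-08-18.
-/

open scoped InnerProductSpace ENNReal
open Filter Topology RCLike

namespace Literature.Analysis.OperatorTheory.Enflo2023

/-! ### (1) The inference with the operator in it, typed -/

/-- v2 p.20 after (46), typed WITH THE OPERATOR: the facts of `RoomClaim` (iterates `v n`, constraint vector `w`,
`(εθ)_n ↓ 0` with ratio `≤ 1 − β`, the p.19–20 step identities) PLUS the manuscript's standing hypotheses on `T`
(v2 pp.1–2, tex:L61 / L221: `T` injective, `R(T) ≠ H`, `R(T)` dense, `0 ∈ σ(T)`, `‖T‖_op = 10⁻²⁰`) PLUS the strongest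
spectral hypothesis of the census (`T` self-adjoint — hence normal, essentially normal, "self-adjoint + compact") PLUS
the p.4 output facts used by the endgame: the distance window `0.3 ≤ ‖x₀ − v_n‖ ≤ 0.7` and (9) for ALL powers,
`|⟨T^j v_n, x₀ − v_n⟩| ≤ (εθ)_n`.  Conclusion as printed: the iterates stay in a room `ρ` from the pivot on.
Refuted below for every `ρ < 0.6` (`not_roomClaimT`). [cite: Enflo2023, v2 p.20, after (46); pp.1–2; (9)] -/
@[claim "Enflo2023" "disputed"]
def RoomClaimT (ρ : ℝ) : Prop :=
  ∀ (H : Type) [NormedAddCommGroup H] [InnerProductSpace ℂ H] [CompleteSpace H]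
    (T : H →L[ℂ] H) (x₀ w : H) (v : ℕ → H) (εθ : ℕ → ℝ) (β : ℝ),
    IsSelfAdjoint T → Function.Injective T → ¬ Function.Surjective T → DenseRange T →
    (0 : ℂ) ∈ spectrum ℂ T → ‖T‖ = 1e-20 →
    ‖x₀‖ = 1 → w ≠ 0 → 0 < β → β < 1 →
    (∀ n, (0.3 : ℝ) ≤ re ⟪x₀, v n⟫_ℂ ∧ re ⟪x₀, v n⟫_ℂ ≤ 0.7) →
    (∀ n, (0.3 : ℝ) ≤ ‖x₀ - v n‖ ∧ ‖x₀ - v n‖ ≤ 0.7) →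
    (∀ n, (εθ n : ℂ) = ⟪v n, x₀ - v n⟫_ℂ) →
    (∀ n, 0 < εθ n) → StrictAnti εθ → Tendsto εθ atTop (𝓝 0) →
    (∀ n, εθ (n + 1) ≤ (1 - β) * εθ n) →
    (∀ n, ‖⟪x₀, v (n + 1) - v n⟫_ℂ‖ ≤ 10 * β * εθ n) →
    (∀ n, ⟪w, v (n + 1) - v n⟫_ℂ = 0) →
    (∀ n j, ‖⟪x₀ - v n, (T ^ j) (v n)⟫_ℂ‖ ≤ εθ n) →
    ∀ n, ‖v n - v 0‖ ≤ ρ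

/-- `RoomClaimT` only ADDS hypotheses to `RoomClaim`, so it is the weaker claim (and its refutation the stronger
refutation). [cite: Enflo2023, v2 p.20, after (46)] -/
theorem roomClaimT_of_roomClaim {ρ : ℝ} (h : RoomClaim ρ) : RoomClaimT ρ := by
  intro H _ _ _ T x₀ w v εθ β _ _ _ _ _ _ hx₀ hw hβ hβ1 H1 _ H2 H3 H4 H5 H6 H7 H8 _
  exact h H x₀ w v εθ β hx₀ hw hβ hβ1 H1 H2 H3 H4 H5 H6 H7 H8

/-! ### (2) The shifted model sequence `v n = (3/5)e₀ + d_n u_n` (generic Hilbert space, orthonormal 4-frame) -/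

namespace RoomModel

variable {H : Type*} [NormedAddCommGroup H] [InnerProductSpace ℂ H]

/-- The model sequence of `RoomClaim.lean` shifted by `e₀/5`: `vT n = (3/5)e₀ + d_n u_n` — same steps, and now ALSO
inside the distance window `‖e₀ − vT n‖² = 0.4 − (εθ)_n`. [cite: Enflo2023, v2 p.20, after (46)] -/
noncomputable def vT (e : Fin 4 → H) (n : ℕ) : H := vModel e n + ((1 / 5 : ℝ) : ℂ) • e 0

variable {e : Fin 4 → H} (he : Orthonormal ℂ e)
include he

omit he in
/-- The shifted model has the same steps as the model. [cite: Enflo2023, v2 p.20, after (46)] -/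
lemma vT_succ_sub (n : ℕ) : vT e (n + 1) - vT e n = vModel e (n + 1) - vModel e n := by
  unfold vT; abel

/-- `⟪e₀, e₀⟫ = 1` for the orthonormal frame. [folklore] -/
lemma inner_e0_e0 : ⟪e 0, e 0⟫_ℂ = 1 := by
  rw [inner_self_eq_norm_sq_to_K, he.1 0]; simp

/-- Shifted model: `⟪x₀, vT n⟫ = 3/5` (so `Re ∈ [0.3, 0.7]`). [cite: Enflo2023, v2 p.20, after (46)] -/
lemma inner_x0_vT (n : ℕ) : ⟪e 0, vT e n⟫_ℂ = ((3 / 5 : ℝ) : ℂ) := by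
  unfold vT
  rw [inner_add_right, inner_smul_right, inner_x0_v he, inner_e0_e0 he]
  push_cast; ring

/-- Shifted model: `⟪vT n, x₀ − vT n⟫ = (εθ)_n` exactly. [cite: Enflo2023, v2 p.20, after (46)] -/
lemma inner_vT_x0_sub_vT (n : ℕ) : ⟪vT e n, e 0 - vT e n⟫_ℂ = (epsModel n : ℂ) := by
  have h1 : e 0 - vT e n = (e 0 - vModel e n) - ((1 / 5 : ℝ) : ℂ) • e 0 := by unfold vT; abel
  have h2 : ⟪vModel e n, e 0⟫_ℂ = ((2 / 5 : ℝ) : ℂ) := by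
    rw [← inner_conj_symm, inner_x0_v he, Complex.conj_ofReal]
  rw [h1, vT, inner_add_left, inner_sub_right (vModel e n) (e 0 - vModel e n),
    inner_sub_right ((((1 / 5 : ℝ) : ℂ)) • e 0) (e 0 - vModel e n), inner_v_x0_sub_v he,
    inner_smul_right, inner_smul_left, inner_smul_left, inner_smul_right, h2, inner_sub_right,
    inner_e0_e0 he, inner_x0_v he]
  simp only [Complex.conj_ofReal]
  push_cast; ring

/-- Shifted model: `‖x₀ − vT n‖² = 0.4 − (εθ)_n`. [cite: Enflo2023, v2 p.20, after (46)] -/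
lemma norm_x0_sub_vT_sq (n : ℕ) : ‖e 0 - vT e n‖ ^ 2 = 0.4 - epsModel n := by
  have h1 : e 0 - vT e n = ((2 / 5 : ℝ) : ℂ) • e 0 - ((dModel n : ℝ) : ℂ) • uModel e n := by
    unfold vT vModel; module
  rw [h1, @norm_sub_sq ℂ, norm_smul, norm_smul, he.1 0, inner_smul_left, inner_smul_right,
    inner_e0_u he]
  have hu : ‖uModel e n‖ = 1 := by
    unfold uModel; split_ifs
    · exact he.1 2
    · exact he.1 3
  rw [hu]
  simp only [mul_zero, Complex.norm_real, Real.norm_eq_abs, mul_one]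
  rw [sq_abs, sq_abs, dModel_sq]
  norm_num
  linarith

/-- Shifted model: the distance window `0.3 ≤ ‖x₀ − vT n‖ ≤ 0.7` holds. [cite: Enflo2023, v2 p.4, (11)] -/
lemma norm_x0_sub_vT_window (n : ℕ) : (0.3 : ℝ) ≤ ‖e 0 - vT e n‖ ∧ ‖e 0 - vT e n‖ ≤ 0.7 := by
  have h := norm_x0_sub_vT_sq he n
  have h0 := norm_nonneg (e 0 - vT e n)
  have h1 := epsModel_pos n
  have h2 := epsModel_le n
  constructor <;> nlinarith

end RoomModel

/-! ### (3) The model operator: a self-adjoint diagonal operator on `ℓ²(ℕ)` -/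

namespace RoomModelT

/-- `ℓ²(ℕ, ℂ)`. [folklore] -/
abbrev ℓ2T : Type := lp (fun _ : ℕ => ℂ) 2

/-- The standard unit vectors `e_i`, `i < 4`, of `ℓ²`. [folklore] -/
noncomputable def eT (i : Fin 4) : ℓ2T := lp.single 2 (i : ℕ) (1 : ℂ)

/-- The four unit vectors are orthonormal. [folklore] -/
lemma orthonormal_eT : Orthonormal ℂ eT := by
  classical
  rw [orthonormal_iff_ite]
  intro i j
  unfold eT
  rw [lp.inner_single_left, lp.single_apply]
  by_cases h : i = j
  · subst h; simp
  · have hij : ((i : ℕ)) ≠ (j : ℕ) := fun hh => h (Fin.ext hh)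
    rw [Pi.single_eq_of_ne hij]; simp [h]

/-- Diagonal weights: `10⁻²⁰` on the frame indices `0,…,3`, `10⁻²⁰/(k+1)` beyond. [folklore] -/
noncomputable def dW (k : ℕ) : ℝ := if k < 4 then 1e-20 else 1e-20 / (k + 1)

/-- The weights are positive. [folklore] -/
lemma dW_pos (k : ℕ) : 0 < dW k := by
  unfold dW; split_ifs <;> positivity

/-- The weights are `≤ 10⁻²⁰`. [folklore] -/
lemma dW_le (k : ℕ) : dW k ≤ 1e-20 := by
  unfold dW; split_ifs with h
  · exact le_rfl
  · rw [div_le_iff₀ (by positivity)]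
    have : (1 : ℝ) ≤ (k : ℝ) + 1 := by have := Nat.cast_nonneg (α := ℝ) k; linarith
    nlinarith

/-- The weights on the frame indices. [folklore] -/
lemma dW_of_lt {k : ℕ} (hk : k < 4) : dW k = 1e-20 := by
  unfold dW; rw [if_pos hk]

/-- A square bound good for summability: `dW k² ≤ 16·10⁻⁴⁰/(k+1)²`. [folklore] -/
lemma dW_sq_le (k : ℕ) : dW k ^ 2 ≤ 16e-40 / ((k : ℝ) + 1) ^ 2 := by
  have hk0 : (0 : ℝ) ≤ k := Nat.cast_nonneg k
  unfold dW; split_ifs with h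
  · have hk : (k : ℝ) ≤ 3 := by exact_mod_cast Nat.lt_succ_iff.mp h
    rw [le_div_iff₀ (by positivity)]
    nlinarith
  · rw [div_pow, div_le_div_iff_of_pos_right (by positivity)]
    norm_num

/-- Elements of `ℓ²` are square-summable. [folklore] -/
lemma summable_sq (f : ℓ2T) : Summable (fun k => ‖f k‖ ^ 2) := by
  have := lp.hasSum_norm (by norm_num : 0 < (2 : ℝ≥0∞).toReal) f
  simp only [ENNReal.toReal_ofNat, Real.rpow_two] at this
  exact this.summable

/-- Pointwise multiplication by the bounded weights preserves `ℓ²`. [folklore] -/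
lemma memℓp_mul (f : ℓ2T) : Memℓp (fun k => (dW k : ℂ) * f k) 2 := by
  rw [memℓp_gen_iff (by norm_num : 0 < (2 : ℝ≥0∞).toReal)]
  simp only [ENNReal.toReal_ofNat, Real.rpow_two]
  refine Summable.of_nonneg_of_le (fun k => by positivity) (fun k => ?_) ((summable_sq f).mul_left (1e-40))
  rw [norm_mul, mul_pow, Complex.norm_real, Real.norm_eq_abs, abs_of_pos (dW_pos k)]
  have h1 := dW_le k
  have h2 := (dW_pos k).le
  have h3 : dW k ^ 2 ≤ 1e-40 := by nlinarith
  exact mul_le_mul_of_nonneg_right h3 (by positivity)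

/-- The diagonal operator as a linear map. [folklore] -/
noncomputable def Dlin : ℓ2T →ₗ[ℂ] ℓ2T where
  toFun f := ⟨fun k => (dW k : ℂ) * f k, memℓp_mul f⟩
  map_add' f g := by
    apply lp.ext
    funext k
    simp [mul_add]
  map_smul' c f := by
    apply lp.ext
    funext k
    simp [lp.coeFn_smul, mul_left_comm]

/-- Coordinates of the linear diagonal map. [folklore] -/
lemma Dlin_apply (f : ℓ2T) (k : ℕ) : (Dlin f) k = (dW k : ℂ) * f k := rfl

/-- Norm bound `‖D f‖ ≤ 10⁻²⁰‖f‖`. [folklore] -/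
lemma norm_Dlin_le (f : ℓ2T) : ‖Dlin f‖ ≤ 1e-20 * ‖f‖ := by
  have h1 := lp.norm_rpow_eq_tsum (by norm_num : 0 < (2 : ℝ≥0∞).toReal) (Dlin f)
  have h2 := lp.norm_rpow_eq_tsum (by norm_num : 0 < (2 : ℝ≥0∞).toReal) f
  simp only [ENNReal.toReal_ofNat, Real.rpow_two] at h1 h2
  have hle : ∑' k, ‖(Dlin f) k‖ ^ 2 ≤ ∑' k, (1e-20 : ℝ) ^ 2 * ‖f k‖ ^ 2 := by
    refine Summable.tsum_le_tsum (fun k => ?_) (summable_sq (Dlin f)) ((summable_sq f).mul_left _)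
    rw [Dlin_apply, norm_mul, mul_pow, Complex.norm_real, Real.norm_eq_abs, abs_of_pos (dW_pos k)]
    exact mul_le_mul_of_nonneg_right (pow_le_pow_left₀ (dW_pos k).le (dW_le k) 2) (by positivity)
  rw [tsum_mul_left] at hle
  have h3 : ‖Dlin f‖ ^ 2 ≤ (1e-20 * ‖f‖) ^ 2 := by
    calc ‖Dlin f‖ ^ 2 = ∑' k, ‖(Dlin f) k‖ ^ 2 := h1
      _ ≤ (1e-20 : ℝ) ^ 2 * ∑' k, ‖f k‖ ^ 2 := hle
      _ = (1e-20 * ‖f‖) ^ 2 := by rw [mul_pow, h2]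
  exact (pow_le_pow_iff_left₀ (norm_nonneg _) (by positivity) two_ne_zero).1 h3

/-- **The model operator `D`**: diagonal, weights `dW`. [folklore] -/
noncomputable def D : ℓ2T →L[ℂ] ℓ2T := Dlin.mkContinuous 1e-20 norm_Dlin_le

/-- Coordinates of `D`: `(D f)_k = dW_k · f_k`. [folklore] -/
@[simp] lemma D_apply (f : ℓ2T) (k : ℕ) : (D f) k = (dW k : ℂ) * f k := rfl

/-- `D` is `10⁻²⁰` times the identity on the frame vectors. [folklore] -/
lemma D_eT (i : Fin 4) : D (eT i) = ((1e-20 : ℝ) : ℂ) • eT i := by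
  apply lp.ext
  funext k
  rw [lp.coeFn_smul, Pi.smul_apply, D_apply, smul_eq_mul]
  unfold eT
  rw [lp.single_apply]
  by_cases hk : k = (i : ℕ)
  · rw [hk, Pi.single_eq_same, dW_of_lt i.isLt]
  · rw [Pi.single_eq_of_ne hk, mul_zero, mul_zero]

/-- `D` is injective (all weights non-zero). [folklore] -/
lemma D_injective : Function.Injective D := by
  refine (injective_iff_map_eq_zero D).2 (fun f hf => ?_)
  apply lp.ext
  funext k
  have hk := congrArg (fun g : ℓ2T => g k) hf
  simp only [D_apply, lp.coeFn_zero, Pi.zero_apply, mul_eq_zero, Complex.ofReal_eq_zero] at hk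
  rcases hk with hk | hk
  · exact absurd hk (dW_pos k).ne'
  · simpa using hk

/-- `D` is self-adjoint (real weights). [folklore] -/
lemma D_isSelfAdjoint : IsSelfAdjoint D := by
  rw [ContinuousLinearMap.isSelfAdjoint_iff_isSymmetric]
  intro f g
  change ⟪D f, g⟫_ℂ = ⟪f, D g⟫_ℂ
  rw [lp.inner_eq_tsum, lp.inner_eq_tsum]
  congr 1
  funext k
  rw [D_apply, D_apply, RCLike.inner_apply', RCLike.inner_apply', map_mul, Complex.conj_ofReal]
  ring

/-- The weight sequence itself is in `ℓ²`. [folklore] -/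
lemma memℓp_dW : Memℓp (fun k => (dW k : ℂ)) 2 := by
  rw [memℓp_gen_iff (by norm_num : 0 < (2 : ℝ≥0∞).toReal)]
  simp only [ENNReal.toReal_ofNat, Real.rpow_two, Complex.norm_real, Real.norm_eq_abs, sq_abs]
  have hs : Summable (fun n : ℕ => 1 / ((n : ℝ) + 1) ^ 2) := by
    have := (summable_nat_add_iff 1).mpr (Real.summable_one_div_nat_pow.mpr one_lt_two)
    simpa [Nat.cast_add, Nat.cast_one] using this
  refine Summable.of_nonneg_of_le (fun k => sq_nonneg _) (fun k => ?_) (hs.mul_left 16e-40)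
  show dW k ^ 2 ≤ 16e-40 * (1 / ((k : ℝ) + 1) ^ 2)
  rw [mul_one_div]; exact dW_sq_le k

/-- `D` is not surjective: the vector `(dW_k)_k` has the non-`ℓ²` preimage `(1,1,1,…)`. [folklore] -/
lemma D_not_surjective : ¬ Function.Surjective D := by
  intro hs
  obtain ⟨f, hf⟩ := hs ⟨fun k => (dW k : ℂ), memℓp_dW⟩
  have hk : ∀ k, f k = 1 := by
    intro k
    have h := congrArg (fun g : ℓ2T => g k) hf
    simp only [D_apply] at h
    have hd : (dW k : ℂ) ≠ 0 := Complex.ofReal_ne_zero.mpr (dW_pos k).ne'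
    have h' : (dW k : ℂ) * f k = (dW k : ℂ) * 1 := by rw [mul_one]; exact h
    exact mul_left_cancel₀ hd h'
  have ht := (summable_sq f).tendsto_atTop_zero
  simp only [hk, norm_one, one_pow] at ht
  have := tendsto_nhds_unique ht tendsto_const_nhds
  exact zero_ne_one this

/-- `D` has dense range (self-adjoint and injective). [folklore] -/
lemma D_denseRange : DenseRange D := by
  have hker : LinearMap.ker (D : ℓ2T →ₗ[ℂ] ℓ2T) = ⊥ :=
    LinearMap.ker_eq_bot.mpr (by exact D_injective)
  have h1 := D.orthogonal_ker
  rw [hker, Submodule.bot_orthogonal_eq_top, ContinuousLinearMap.isSelfAdjoint_iff'.1 D_isSelfAdjoint] at h1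
  have h2 : Dense ((LinearMap.range (D : ℓ2T →ₗ[ℂ] ℓ2T) : Submodule ℂ ℓ2T) : Set ℓ2T) :=
    Submodule.dense_iff_topologicalClosure_eq_top.mpr h1.symm
  have h3 : ((LinearMap.range (D : ℓ2T →ₗ[ℂ] ℓ2T) : Submodule ℂ ℓ2T) : Set ℓ2T) = Set.range D := by
    ext x
    simp only [SetLike.mem_coe, LinearMap.mem_range, Set.mem_range, ContinuousLinearMap.coe_coe]
  rw [h3] at h2
  exact h2

/-- `0 ∈ σ(D)` (not surjective ⇒ not invertible). [folklore] -/
lemma zero_mem_spectrum_D : (0 : ℂ) ∈ spectrum ℂ D := by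
  rw [spectrum.mem_iff, map_zero, zero_sub, IsUnit.neg_iff]
  intro hu
  apply D_not_surjective
  obtain ⟨u, hu⟩ := hu
  intro y
  refine ⟨(↑u⁻¹ : ℓ2T →L[ℂ] ℓ2T) y, ?_⟩
  have h := congrArg (fun S : ℓ2T →L[ℂ] ℓ2T => S y) u.mul_inv
  rw [hu] at h
  simpa using h

/-- `‖D‖ = 10⁻²⁰` (the manuscript's normalisation). [folklore] -/
lemma norm_D : ‖D‖ = 1e-20 := by
  refine le_antisymm (LinearMap.mkContinuous_norm_le _ (by norm_num) _) ?_
  have h1 := D.le_opNorm (eT 0)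
  have h2 : ‖eT 0‖ = 1 := by
    unfold eT; rw [lp.norm_single (by norm_num)]; simp
  rw [D_eT, norm_smul, h2, Complex.norm_real, Real.norm_eq_abs, abs_of_pos (by norm_num), mul_one,
    mul_one] at h1
  exact h1

/-- `D` acts as the scalar `10⁻²⁰` on the shifted model sequence (which lives in `span{e₀, e₂, e₃}`). [folklore] -/
lemma D_vT (n : ℕ) : D (RoomModel.vT eT n) = ((1e-20 : ℝ) : ℂ) • RoomModel.vT eT n := by
  unfold RoomModel.vT RoomModel.vModel RoomModel.uModel
  split_ifs <;> simp only [map_add, map_smul, D_eT, smul_add, smul_smul, mul_comm]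

/-- Hence every power: `D^j vT_n = 10^{-20j} vT_n`. [folklore] -/
lemma D_pow_vT (n j : ℕ) : (D ^ j) (RoomModel.vT eT n) = (((1e-20 : ℝ) : ℂ) ^ j) • RoomModel.vT eT n := by
  induction j with
  | zero => simp
  | succ j ih =>
    rw [pow_succ]
    change (D ^ j) (D (RoomModel.vT eT n)) = _
    rw [D_vT, map_smul, ih, smul_smul, pow_succ, mul_comm]

/-- (9) holds in the model with room to spare: `|⟨x₀ − vT_n, D^j vT_n⟩| = 10^{-20j}(εθ)_n ≤ (εθ)_n`.
[cite: Enflo2023, v2 p.4, (9)] -/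
lemma nine_holds (n j : ℕ) :
    ‖⟪eT 0 - RoomModel.vT eT n, (D ^ j) (RoomModel.vT eT n)⟫_ℂ‖ ≤ RoomModel.epsModel n := by
  rw [D_pow_vT, inner_smul_right, ← inner_conj_symm, RoomModel.inner_vT_x0_sub_vT orthonormal_eT,
    Complex.conj_ofReal, norm_mul, norm_pow, Complex.norm_real, Complex.norm_real, Real.norm_eq_abs,
    Real.norm_eq_abs, abs_of_pos (RoomModel.epsModel_pos n), abs_of_pos (by norm_num : (0:ℝ) < 1e-20)]
  have h1 : (1e-20 : ℝ) ^ j ≤ 1 := pow_le_one₀ (by norm_num) (by norm_num)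
  have h2 := RoomModel.epsModel_pos n
  nlinarith

/-- **The model violates `RoomClaimT ρ` for every `ρ < 0.6`.** [cite: Enflo2023, v2 p.20, after (46)] -/
theorem model_violatesT (ρ : ℝ) (hρ : ρ < 0.6) (hRC : RoomClaimT ρ) : False := by
  have he := orthonormal_eT
  have hx₀ : ‖eT 0‖ = 1 := he.1 0
  have hw : eT 1 ≠ 0 := by
    intro h; have := he.1 1; rw [h, norm_zero] at this; exact zero_ne_one this
  have H1 : ∀ n, (0.3 : ℝ) ≤ re ⟪eT 0, RoomModel.vT eT n⟫_ℂ ∧ re ⟪eT 0, RoomModel.vT eT n⟫_ℂ ≤ 0.7 := by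
    intro n; rw [RoomModel.inner_x0_vT he]; norm_num
  have H1' := RoomModel.norm_x0_sub_vT_window he
  have H2 : ∀ n, (RoomModel.epsModel n : ℂ) = ⟪RoomModel.vT eT n, eT 0 - RoomModel.vT eT n⟫_ℂ :=
    fun n => (RoomModel.inner_vT_x0_sub_vT he n).symm
  have H3 : ∀ n, RoomModel.epsModel (n + 1) ≤ (1 - 1 / 2) * RoomModel.epsModel n := by
    intro n; rw [RoomModel.epsModel_succ]; norm_num
  have H4 : ∀ n, ‖⟪eT 0, RoomModel.vT eT (n + 1) - RoomModel.vT eT n⟫_ℂ‖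
      ≤ 10 * (1 / 2) * RoomModel.epsModel n := by
    intro n
    rw [RoomModel.vT_succ_sub, RoomModel.inner_x0_step he, norm_zero]
    have := RoomModel.epsModel_pos n; positivity
  have H5 : ∀ n, ⟪eT 1, RoomModel.vT eT (n + 1) - RoomModel.vT eT n⟫_ℂ = 0 := by
    intro n; rw [RoomModel.vT_succ_sub]; exact RoomModel.inner_w_step he n
  have hall := hRC ℓ2T D (eT 0) (eT 1) (RoomModel.vT eT) RoomModel.epsModel (1 / 2)
    D_isSelfAdjoint D_injective D_not_surjective D_denseRange zero_mem_spectrum_D norm_D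
    hx₀ hw (by norm_num) (by norm_num) H1 H1' H2 RoomModel.epsModel_pos RoomModel.epsModel_strictAnti
    RoomModel.epsModel_tendsto H3 H4 H5 nine_holds 1
  have hstep := RoomModel.norm_step_ge he 0
  rw [RoomModel.vT_succ_sub] at hall
  simp only [zero_add] at hstep hall
  linarith

end RoomModelT

open RoomModelT in
/-- **Lean refuses the p.20 inference even with the operator in it.**  For every `ρ < 0.6` the T-aware room claim
is false: witnessed on `ℓ²(ℕ)` by a SELF-ADJOINT, injective, non-surjective, dense-range diagonal operator `D` with
`0 ∈ σ(D)` and `‖D‖ = 10⁻²⁰` (every standing hypothesis of v2 pp.1–2), iterates satisfying every listed fact of p.19–20,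
the distance window and (9) for all powers — and moving by `≥ 0.67` at every step.  So no hypothesis of spectral type on
`T` (self-adjoint ⊂ normal ⊂ essentially normal; "self-adjoint + compact") repairs the inference; census rows R9/R10:
the THEOREM is known resp. open for those classes, the manuscript's MECHANISM is refuted for them. [cite: Enflo2023, v2 p.20, after (46)] -/
theorem not_roomClaimT (ρ : ℝ) (hρ : ρ < 0.6) : ¬ RoomClaimT ρ :=
  fun h => model_violatesT ρ hρ h

end Literature.Analysis.OperatorTheory.Enflo2023
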